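import Mathlib
import Literature.Analysis.SpecialFunctions.BesselHeatKernelGreen
import HarnessLib

/-!
# The Duhamel–Volterra operator of a radial heat kernel (nonnegative kernels, `ℝ≥0∞`-valued)

For the comparison of the radial heat kernels `q^{(κ)}_t(x,y)` of different index (`BesselHeatKernel.lean`) one iterates
the one-step Duhamel identity `q^{(μ)} = q^{(ν)} + (u_ν - u_μ) · q^{(ν)} V ∗ q^{(μ)}` (`u_κ = κ²/2`, `V(z) = z⁻²`, convolution in
time and in space w.r.t. `z dz`).  All kernels being NONNEGATIVE, the bookkeeping of the iteration (Tonelli, monotone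
convergence, series) is done with `ℝ≥0∞`-valued kernels and lower Lebesgue integrals, where no integrability side
conditions arise.  This file sets up, for a fixed right endpoint `y`:

* `heatKernelENN κ y` — the guarded kernel `(t,x) ↦ 𝟙{t>0, x>0} · q^{(κ)}_t(x,y)` in `ℝ≥0∞`;
* `duhamelWeight ν`, `duhamelOp ν` — the Volterra operator
  `(T_ν K)(t,x) = ∫⁻_{s>0} ∫⁻_{z>0} 𝟙{s<t, x>0} q^{(ν)}_{t-s}(x,z) z⁻¹ · K(s,z)`
  (i.e. `K ↦ q^{(ν)} V ∗ K` with the measure `z dz`);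
* joint measurability (`measurable_besselHeatKernel`, `measurable_heatKernelENN`, `measurable_duhamelOp`), monotonicity in
  `K` and in the weight (`duhamelOp_mono`, `duhamelOp_mono_weight`), additivity and homogeneity (`duhamelOp_add`,
  `duhamelOp_const_mul`), and the same for the iterates `(T_ν)^[j]`.

The Duhamel identity itself in this language and the Neumann series are in the sequel files.  Source of the method:
the Feynman–Kac/Duhamel perturbation series for Bessel processes [RevuzYor1999, Ch. XI §1; Yor1980].

## References
* D. Revuz, M. Yor, *Continuous Martingales and Brownian Motion*, 3rd ed. (1999), Ch. XI §1. [RevuzYor1999]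
-/

noncomputable section

open Filter Topology Real MeasureTheory Set Function
open scoped NNReal ENNReal BigOperators

namespace Literature.Analysis.SpecialFunctions

/-! ## Measurability of the kernel in all variables -/

section Measurability

/-- `(t,x,z) ↦ q^{(κ)}_t(x,z)` is jointly Borel measurable (`κ ≥ 0`). [cite: RevuzYor1999, Ch. XI §1] -/
theorem measurable_besselHeatKernel {κ : ℝ} (hκ : 0 ≤ κ) :
    Measurable fun p : ℝ × ℝ × ℝ => besselHeatKernel κ p.1 p.2.1 p.2.2 := by
  unfold besselHeatKernel
  have h1 : Measurable fun p : ℝ × ℝ × ℝ => p.1⁻¹ := measurable_fst.inv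
  have h2 : Measurable fun p : ℝ × ℝ × ℝ => Real.exp (-(p.2.1 ^ 2 + p.2.2 ^ 2) / (2 * p.1)) :=
    Real.measurable_exp.comp (by fun_prop)
  have h3 : Measurable fun p : ℝ × ℝ × ℝ => besselIR κ (p.2.1 * p.2.2 / p.1) :=
    (continuous_besselIR hκ).measurable.comp (by fun_prop)
  exact (h1.mul h2).mul h3

end Measurability

/-! ## The guarded `ℝ≥0∞`-valued kernels and the Volterra operator -/

section Defs

/-- The guarded kernel `Q_κ(t,x) = 𝟙{t > 0, x > 0} · q^{(κ)}_t(x,y)` in `ℝ≥0∞` (right endpoint `y` fixed).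
[cite: RevuzYor1999, Ch. XI §1] -/
def heatKernelENN (κ y : ℝ) (t x : ℝ) : ℝ≥0∞ :=
  if 0 < t ∧ 0 < x then ENNReal.ofReal (besselHeatKernel κ t x y) else 0

/-- The weight `𝟙{s < t, x > 0} · q^{(ν)}_{t-s}(x,z) z⁻¹` of the Volterra operator. [cite: RevuzYor1999, Ch. XI §1] -/
def duhamelWeight (ν t x s z : ℝ) : ℝ≥0∞ :=
  if s < t ∧ 0 < x then ENNReal.ofReal (besselHeatKernel ν (t - s) x z / z) else 0

/-- **The Duhamel–Volterra operator** `(T_ν K)(t,x) = ∫⁻_{s>0} ∫⁻_{z>0} 𝟙{s<t, x>0} q^{(ν)}_{t-s}(x,z) z⁻¹ K(s,z)`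
(`= q^{(ν)} V ∗ K`, `V = z⁻²`, space measure `z dz`). [cite: RevuzYor1999, Ch. XI §1] -/
def duhamelOp (ν : ℝ) (K : ℝ → ℝ → ℝ≥0∞) (t x : ℝ) : ℝ≥0∞ :=
  ∫⁻ s in Ioi (0 : ℝ), ∫⁻ z in Ioi (0 : ℝ), duhamelWeight ν t x s z * K s z

end Defs

section Basic

variable {ν κ y : ℝ}

/-- Off the quadrant the guarded kernel vanishes. [cite: RevuzYor1999, Ch. XI §1] -/
theorem heatKernelENN_of_not {t x : ℝ} (h : ¬(0 < t ∧ 0 < x)) : heatKernelENN κ y t x = 0 := by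
  simp [heatKernelENN, h]

/-- On the quadrant the guarded kernel is `q^{(κ)}_t(x,y)`. [cite: RevuzYor1999, Ch. XI §1] -/
theorem heatKernelENN_of_pos {t x : ℝ} (ht : 0 < t) (hx : 0 < x) :
    heatKernelENN κ y t x = ENNReal.ofReal (besselHeatKernel κ t x y) := by
  simp [heatKernelENN, ht, hx]

/-- The guarded kernel is finite. [cite: RevuzYor1999, Ch. XI §1] -/
theorem heatKernelENN_lt_top (t x : ℝ) : heatKernelENN κ y t x < ∞ := by
  unfold heatKernelENN; split_ifs <;> simp

/-- The weight vanishes for `s ≥ t`. [cite: RevuzYor1999, Ch. XI §1] -/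
theorem duhamelWeight_of_le {t x s z : ℝ} (h : t ≤ s) : duhamelWeight ν t x s z = 0 := by
  simp [duhamelWeight, not_lt.2 h]

/-- The weight on its support. [cite: RevuzYor1999, Ch. XI §1] -/
theorem duhamelWeight_of_pos {t x s z : ℝ} (hst : s < t) (hx : 0 < x) :
    duhamelWeight ν t x s z = ENNReal.ofReal (besselHeatKernel ν (t - s) x z / z) := by
  simp [duhamelWeight, hst, hx]

/-- The weight is finite. [cite: RevuzYor1999, Ch. XI §1] -/
theorem duhamelWeight_lt_top (t x s z : ℝ) : duhamelWeight ν t x s z < ∞ := by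
  unfold duhamelWeight; split_ifs <;> simp

/-- `T_ν K` vanishes off the quadrant `t > 0, x > 0`. [cite: RevuzYor1999, Ch. XI §1] -/
theorem duhamelOp_of_not (K : ℝ → ℝ → ℝ≥0∞) {t x : ℝ} (h : ¬(0 < t ∧ 0 < x)) : duhamelOp ν K t x = 0 := by
  unfold duhamelOp
  have hW : ∀ s, 0 < s → ∀ z, duhamelWeight ν t x s z = 0 := by
    intro s hs z
    unfold duhamelWeight
    split_ifs with h'
    · exact absurd ⟨hs.trans h'.1, h'.2⟩ h
    · rfl
  have hG : ∀ s ∈ Ioi (0 : ℝ), (∫⁻ z in Ioi (0 : ℝ), duhamelWeight ν t x s z * K s z) = 0 := by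
    intro s hs
    simp [hW s hs]
  rw [setLIntegral_congr_fun measurableSet_Ioi hG, lintegral_zero]

/-- Restriction to the time interval `(0,t)`: `(T_ν K)(t,x) = ∫⁻_{0<s<t} ∫⁻_{z>0} …`. [cite: RevuzYor1999, Ch. XI §1] -/
theorem duhamelOp_eq_lintegral_Ioo (K : ℝ → ℝ → ℝ≥0∞) (t x : ℝ) :
    duhamelOp ν K t x = ∫⁻ s in Ioo (0 : ℝ) t, ∫⁻ z in Ioi (0 : ℝ), duhamelWeight ν t x s z * K s z := by
  unfold duhamelOp
  set G : ℝ → ℝ≥0∞ := fun s => ∫⁻ z in Ioi (0 : ℝ), duhamelWeight ν t x s z * K s z with hG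
  have hG0 : ∀ s, t ≤ s → G s = 0 := fun s hs => by simp [hG, duhamelWeight_of_le (ν := ν) (x := x) (z := _) hs]
  by_cases ht : 0 < t
  · have hsplit : Ioi (0 : ℝ) = Ioo 0 t ∪ Ici t := (Ioo_union_Ici_eq_Ioi ht).symm
    have hdisj : Disjoint (Ioo (0 : ℝ) t) (Ici t) :=
      Set.disjoint_left.2 fun s hs hs' => (not_le.2 hs.2) hs'
    have hIci : ∫⁻ s in Ici t, G s = 0 := by
      rw [setLIntegral_congr_fun measurableSet_Ici (fun s hs => hG0 s hs), lintegral_zero]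
    calc ∫⁻ s in Ioi 0, G s = ∫⁻ s in Ioo 0 t ∪ Ici t, G s := by rw [← hsplit]
      _ = (∫⁻ s in Ioo 0 t, G s) + ∫⁻ s in Ici t, G s := lintegral_union measurableSet_Ici hdisj
      _ = ∫⁻ s in Ioo 0 t, G s := by rw [hIci, add_zero]
  · have h1 : Ioo (0 : ℝ) t = ∅ := Ioo_eq_empty (by simpa using ht)
    rw [h1, Measure.restrict_empty, lintegral_zero_measure]
    have hall : ∀ s ∈ Ioi (0 : ℝ), G s = 0 := fun s hs =>
      hG0 s (le_of_lt (lt_of_le_of_lt (not_lt.1 ht) hs))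
    rw [setLIntegral_congr_fun measurableSet_Ioi hall, lintegral_zero]

end Basic

/-! ## Measurability -/

section Meas

variable {ν κ y : ℝ}

/-- The guarded kernel is jointly measurable. [cite: RevuzYor1999, Ch. XI §1] -/
theorem measurable_heatKernelENN (hκ : 0 ≤ κ) (y : ℝ) : Measurable (uncurry (heatKernelENN κ y)) := by
  have hset : MeasurableSet {p : ℝ × ℝ | 0 < p.1 ∧ 0 < p.2} :=
    (measurableSet_lt measurable_const measurable_fst).inter (measurableSet_lt measurable_const measurable_snd)
  have hf : Measurable fun p : ℝ × ℝ => ENNReal.ofReal (besselHeatKernel κ p.1 p.2 y) :=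
    ENNReal.measurable_ofReal.comp
      ((measurable_besselHeatKernel hκ).comp (measurable_fst.prodMk (measurable_snd.prodMk measurable_const)))
  have hEq : uncurry (heatKernelENN κ y) =
      fun p : ℝ × ℝ => if 0 < p.1 ∧ 0 < p.2 then ENNReal.ofReal (besselHeatKernel κ p.1 p.2 y) else 0 := by
    ext ⟨t, x⟩
    simp [heatKernelENN, uncurry]
  rw [hEq]
  exact Measurable.ite hset hf measurable_const

/-- The weight is jointly measurable in `(t,x,s,z)`. [cite: RevuzYor1999, Ch. XI §1] -/
theorem measurable_duhamelWeight (hν : 0 ≤ ν) :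
    Measurable fun p : (ℝ × ℝ) × ℝ × ℝ => duhamelWeight ν p.1.1 p.1.2 p.2.1 p.2.2 := by
  have hset : MeasurableSet {p : (ℝ × ℝ) × ℝ × ℝ | p.2.1 < p.1.1 ∧ 0 < p.1.2} :=
    (measurableSet_lt (measurable_snd.fst) (measurable_fst.fst)).inter
      (measurableSet_lt measurable_const measurable_fst.snd)
  have hf : Measurable fun p : (ℝ × ℝ) × ℝ × ℝ =>
      ENNReal.ofReal (besselHeatKernel ν (p.1.1 - p.2.1) p.1.2 p.2.2 / p.2.2) := by
    refine ENNReal.measurable_ofReal.comp (Measurable.div ?_ measurable_snd.snd)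
    exact (measurable_besselHeatKernel hν).comp
      ((measurable_fst.fst.sub measurable_snd.fst).prodMk (measurable_fst.snd.prodMk measurable_snd.snd))
  have hEq : (fun p : (ℝ × ℝ) × ℝ × ℝ => duhamelWeight ν p.1.1 p.1.2 p.2.1 p.2.2) =
      fun p => if p.2.1 < p.1.1 ∧ 0 < p.1.2 then
        ENNReal.ofReal (besselHeatKernel ν (p.1.1 - p.2.1) p.1.2 p.2.2 / p.2.2) else 0 := by
    ext ⟨⟨t, x⟩, s, z⟩
    simp [duhamelWeight]
  rw [hEq]
  exact Measurable.ite hset hf measurable_const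

/-- **`T_ν` preserves joint measurability.** [cite: RevuzYor1999, Ch. XI §1] -/
theorem measurable_duhamelOp (hν : 0 ≤ ν) {K : ℝ → ℝ → ℝ≥0∞} (hK : Measurable (uncurry K)) :
    Measurable (uncurry (duhamelOp ν K)) := by
  -- the integrand in all variables `((t,x),(s,z))`
  have hF : Measurable fun p : (ℝ × ℝ) × ℝ × ℝ => duhamelWeight ν p.1.1 p.1.2 p.2.1 p.2.2 * K p.2.1 p.2.2 :=
    (measurable_duhamelWeight hν).mul (hK.comp (measurable_snd.fst.prodMk measurable_snd.snd))
  -- inner integral in `z`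
  have hG : Measurable fun q : ((ℝ × ℝ) × ℝ) × ℝ =>
      duhamelWeight ν q.1.1.1 q.1.1.2 q.1.2 q.2 * K q.1.2 q.2 :=
    hF.comp ((measurable_fst.fst).prodMk (measurable_fst.snd.prodMk measurable_snd))
  have hInner : Measurable fun q : (ℝ × ℝ) × ℝ =>
      ∫⁻ z in Ioi (0 : ℝ), duhamelWeight ν q.1.1 q.1.2 q.2 z * K q.2 z :=
    hG.lintegral_prod_right'
  have hOuter : Measurable fun p : ℝ × ℝ =>
      ∫⁻ s in Ioi (0 : ℝ), ∫⁻ z in Ioi (0 : ℝ), duhamelWeight ν p.1 p.2 s z * K s z :=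
    hInner.lintegral_prod_right'
  have hEq : uncurry (duhamelOp ν K) = fun p : ℝ × ℝ =>
      ∫⁻ s in Ioi (0 : ℝ), ∫⁻ z in Ioi (0 : ℝ), duhamelWeight ν p.1 p.2 s z * K s z := by
    ext ⟨t, x⟩
    rfl
  rw [hEq]
  exact hOuter

/-- The iterates `(T_ν)^[j] K` are jointly measurable. [cite: RevuzYor1999, Ch. XI §1] -/
theorem measurable_duhamelOp_iterate (hν : 0 ≤ ν) {K : ℝ → ℝ → ℝ≥0∞} (hK : Measurable (uncurry K)) (j : ℕ) :
    Measurable (uncurry ((duhamelOp ν)^[j] K)) := by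
  induction j with
  | zero => simpa using hK
  | succ j ih =>
    rw [Function.iterate_succ_apply']
    exact measurable_duhamelOp hν ih

end Meas

/-! ## Monotonicity, additivity, homogeneity -/

section Algebra

variable {ν μ : ℝ}

/-- `T_ν` is monotone in `K`. [cite: RevuzYor1999, Ch. XI §1] -/
theorem duhamelOp_mono {K K' : ℝ → ℝ → ℝ≥0∞} (h : ∀ s z, 0 < s → 0 < z → K s z ≤ K' s z) (t x : ℝ) :
    duhamelOp ν K t x ≤ duhamelOp ν K' t x := by
  unfold duhamelOp
  refine lintegral_mono_ae (ae_restrict_of_forall_mem measurableSet_Ioi fun s hs => ?_)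
  exact lintegral_mono_ae (ae_restrict_of_forall_mem measurableSet_Ioi fun z hz => mul_le_mul' le_rfl (h s z hs hz))

/-- `T_ν` is monotone in the weight: if `q^{(ν)}_τ(x,z) ≤ q^{(μ)}_τ(x,z)` for all `τ, x, z > 0` then `T_ν K ≤ T_μ K`.
[cite: RevuzYor1999, Ch. XI §1] -/
theorem duhamelOp_mono_weight {K : ℝ → ℝ → ℝ≥0∞}
    (h : ∀ τ x z : ℝ, 0 < τ → 0 < x → 0 < z → besselHeatKernel ν τ x z ≤ besselHeatKernel μ τ x z) (t x : ℝ) :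
    duhamelOp ν K t x ≤ duhamelOp μ K t x := by
  unfold duhamelOp
  refine lintegral_mono_ae (ae_restrict_of_forall_mem measurableSet_Ioi fun s _ => ?_)
  refine lintegral_mono_ae (ae_restrict_of_forall_mem measurableSet_Ioi fun z hz => mul_le_mul' ?_ le_rfl)
  unfold duhamelWeight
  split_ifs with h'
  · exact ENNReal.ofReal_le_ofReal (div_le_div_of_nonneg_right (h _ _ _ (by linarith [h'.1]) h'.2 hz) (le_of_lt hz))
  · exact le_rfl

/-- The iterates are monotone in `K`. [cite: RevuzYor1999, Ch. XI §1] -/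
theorem duhamelOp_iterate_mono {K K' : ℝ → ℝ → ℝ≥0∞} (h : ∀ s z, K s z ≤ K' s z) (j : ℕ) (t x : ℝ) :
    (duhamelOp ν)^[j] K t x ≤ (duhamelOp ν)^[j] K' t x := by
  induction j generalizing t x with
  | zero => simpa using h t x
  | succ j ih =>
    rw [Function.iterate_succ_apply', Function.iterate_succ_apply']
    exact duhamelOp_mono (fun s z _ _ => ih s z) t x

/-- The iterates are monotone in the weight. [cite: RevuzYor1999, Ch. XI §1] -/
theorem duhamelOp_iterate_mono_weight {K : ℝ → ℝ → ℝ≥0∞}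
    (h : ∀ τ x z : ℝ, 0 < τ → 0 < x → 0 < z → besselHeatKernel ν τ x z ≤ besselHeatKernel μ τ x z) (j : ℕ) (t x : ℝ) :
    (duhamelOp ν)^[j] K t x ≤ (duhamelOp μ)^[j] K t x := by
  induction j generalizing t x with
  | zero => simp
  | succ j ih =>
    rw [Function.iterate_succ_apply', Function.iterate_succ_apply']
    exact (duhamelOp_mono (fun s z _ _ => ih s z) t x).trans (duhamelOp_mono_weight h t x)

/-- **Additivity**: `T_ν (K + K') = T_ν K + T_ν K'` (for measurable `K`). [cite: RevuzYor1999, Ch. XI §1] -/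
theorem duhamelOp_add (hν : 0 ≤ ν) {K K' : ℝ → ℝ → ℝ≥0∞} (hK : Measurable (uncurry K)) (t x : ℝ) :
    duhamelOp ν (K + K') t x = duhamelOp ν K t x + duhamelOp ν K' t x := by
  unfold duhamelOp
  have hF : Measurable fun p : (ℝ × ℝ) × ℝ × ℝ => duhamelWeight ν p.1.1 p.1.2 p.2.1 p.2.2 * K p.2.1 p.2.2 :=
    (measurable_duhamelWeight hν).mul (hK.comp (measurable_snd.fst.prodMk measurable_snd.snd))
  have hW : ∀ s, Measurable fun z => duhamelWeight ν t x s z * K s z := fun s => by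
    have hg : Measurable fun z : ℝ => (((t, x), (s, z)) : (ℝ × ℝ) × ℝ × ℝ) := by fun_prop
    exact hF.comp hg
  have hinner : ∀ s, ∫⁻ z in Ioi (0 : ℝ), duhamelWeight ν t x s z * (K + K') s z =
      (∫⁻ z in Ioi (0 : ℝ), duhamelWeight ν t x s z * K s z) + ∫⁻ z in Ioi (0 : ℝ), duhamelWeight ν t x s z * K' s z := by
    intro s
    rw [← lintegral_add_left (hW s)]
    refine lintegral_congr fun z => ?_
    simp only [Pi.add_apply, mul_add]
  simp_rw [hinner]
  rw [lintegral_add_left]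
  -- measurability of `s ↦ ∫⁻ z, W * K`
  have hG : Measurable fun q : ℝ × ℝ => duhamelWeight ν t x q.1 q.2 * K q.1 q.2 := by
    have hg : Measurable fun q : ℝ × ℝ => (((t, x), q) : (ℝ × ℝ) × ℝ × ℝ) := by fun_prop
    exact hF.comp hg
  exact hG.lintegral_prod_right'

/-- **Homogeneity**: `T_ν (c · K) = c · T_ν K` for a finite constant `c`. [cite: RevuzYor1999, Ch. XI §1] -/
theorem duhamelOp_const_mul {K : ℝ → ℝ → ℝ≥0∞} {c : ℝ≥0∞} (hc : c ≠ ∞) (t x : ℝ) :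
    duhamelOp ν (fun s z => c * K s z) t x = c * duhamelOp ν K t x := by
  unfold duhamelOp
  have hinner : ∀ s, ∫⁻ z in Ioi (0 : ℝ), duhamelWeight ν t x s z * (c * K s z) =
      c * ∫⁻ z in Ioi (0 : ℝ), duhamelWeight ν t x s z * K s z := by
    intro s
    rw [← lintegral_const_mul' _ _ hc]
    refine lintegral_congr fun z => ?_
    ring
  simp_rw [hinner]
  rw [lintegral_const_mul' _ _ hc]

/-- Additivity of the iterates. [cite: RevuzYor1999, Ch. XI §1] -/
theorem duhamelOp_iterate_add (hν : 0 ≤ ν) {K K' : ℝ → ℝ → ℝ≥0∞} (hK : Measurable (uncurry K))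
    (j : ℕ) (t x : ℝ) :
    (duhamelOp ν)^[j] (K + K') t x = (duhamelOp ν)^[j] K t x + (duhamelOp ν)^[j] K' t x := by
  induction j generalizing t x with
  | zero => simp
  | succ j ih =>
    rw [Function.iterate_succ_apply', Function.iterate_succ_apply', Function.iterate_succ_apply']
    have hfun : (duhamelOp ν)^[j] (K + K') = (duhamelOp ν)^[j] K + (duhamelOp ν)^[j] K' := by
      funext s z; exact ih s z
    rw [hfun]
    exact duhamelOp_add hν (measurable_duhamelOp_iterate hν hK j) t x

/-- Homogeneity of the iterates. [cite: RevuzYor1999, Ch. XI §1] -/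
theorem duhamelOp_iterate_const_mul {K : ℝ → ℝ → ℝ≥0∞} {c : ℝ≥0∞} (hc : c ≠ ∞) (j : ℕ) (t x : ℝ) :
    (duhamelOp ν)^[j] (fun s z => c * K s z) t x = c * (duhamelOp ν)^[j] K t x := by
  induction j generalizing t x with
  | zero => simp
  | succ j ih =>
    rw [Function.iterate_succ_apply', Function.iterate_succ_apply']
    have hfun : (duhamelOp ν)^[j] (fun s z => c * K s z) = fun s z => c * (duhamelOp ν)^[j] K s z := by
      funext s z; exact ih s z
    rw [hfun]
    exact duhamelOp_const_mul hc t x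

end Algebra

end Literature.Analysis.SpecialFunctions

end
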